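import Literature.AlgebraicGeometry.Milne1999.DivisorClassesSymmetricCentralizer
import Literature.AlgebraicGeometry.Motives.FaltingsAbelianOfFinitenessIProofs
import Literature.AlgebraicGeometry.Motives.AbelianVarietyEndAlgebraInstances
import Literature.RingTheory.SimpleModule.SemisimpleBaseChange
import Mathlib.RingTheory.SimpleModule.Basic
import HarnessLib

/-!
# The bicommutant `E'' = End⁰(A) ⊗ ℂ ⊆ End_ℂ H¹(A(ℂ); ℂ)` is a semisimple ring

Family `hodge`, layer `Literature/AlgebraicGeometry/Milne1999`, namespace `Literature.AlgebraicGeometry.Milne1999`.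
No named fact, no `sorry` (D-0026, net debt 0).  Cell `pub-hodgecm2` (COR-CM), seat `lit-milne`.

[Milne 1999, §1 p. 642 and §2 p. 645]: "`End⁰(A)` is a semisimple `ℚ`-algebra (Poincaré) […] `E ⊗ k` is
semisimple".  On the tree's carriers: the subalgebra `E'' = (C(A) ⊗ ℂ)' ⊆ End_ℂ H¹(A(ℂ); ℂ)` — the `ℂ`-span of
the `φ^*`, `φ ∈ End(A)` (`mem_bicommutant_iff_mem_span`, Riemann) — is the image of the semisimple ring
`(ℂ ⊗_ℚ End⁰(A))ᵒᵖ` (`End⁰(A)` semisimple: the tree's `AbelianVariety.isSemisimpleRing_endAlgebra_of_perfectField`;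
base change: the tree's `isSemisimpleRing_baseChange`) under `z ⊗ (q ⊗ φ) ↦ z q φ^*`, hence semisimple
(`RingHom.isSemisimpleRing_of_surjective`).  Main result: `isSemisimpleRing_bicommutant`.
[cite: Milne1999LefschetzClasses, §1 p. 642 and §2 p. 645] [cite: MumfordAV1970, §19 Cor. 2 of Thm. 1]
-/

noncomputable section

open scoped TensorProduct
open CategoryTheory
open Literature.AlgebraicGeometry.HodgeTheory
open Literature.AlgebraicGeometry.Motives
open Literature.AlgebraicGeometry.VanGeemen1994 (pullbackOne)

namespace Literature.AlgebraicGeometry.Milne1999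

variable (A : AbelianVariety ℂ)

/-- The opposite algebra of `End_ℂ H¹(A(ℂ); ℂ)`, the natural target of `φ ↦ φ^*`. [folklore] -/
abbrev EndHOneOp : Type := (Module.End ℂ (complexBetti A.X 1))ᵐᵒᵖ

/-- `ℚ`-algebra structure on `(End_ℂ H¹)ᵒᵖ` through `ℚ → ℂ`. [folklore] -/
instance instAlgebraRatEndHOneOp : Algebra ℚ (EndHOneOp A) :=
  ((algebraMap ℂ (EndHOneOp A)).comp (algebraMap ℚ ℂ)).toAlgebra' fun q x => Algebra.commutes (q : ℂ) x

/-- The `ℚ`-structure factors through `ℂ`. [folklore] -/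
instance instIsScalarTowerRatComplexEndHOneOp : IsScalarTower ℚ ℂ (EndHOneOp A) :=
  IsScalarTower.of_algebraMap_eq fun _ => rfl

/-- The `ℤ`-structure factors through `ℚ`. [folklore] -/
instance instIsScalarTowerIntRatEndHOneOp : IsScalarTower ℤ ℚ (EndHOneOp A) :=
  IsScalarTower.of_algebraMap_eq fun n => by simp

/-- `φ^*` for `φ = 𝟙`. [folklore] -/
private theorem pullbackOne_one : pullbackOne A (1 : End A) = 1 :=
  LinearMap.ext fun v => pullbackOne_id_apply (A := A) v

/-- `(f * g)^* = g^*`-then-`f^*`: `φ ↦ φ^*` is anti-multiplicative for the multiplication of `End A`.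
[cite: Milne1999LefschetzClasses, §1 p. 642] -/
private theorem pullbackOne_mul (f g : End A) : pullbackOne A (f * g) = pullbackOne A g * pullbackOne A f := by
  change (complexBetti.map (g ≫ f).hom.hom.hom 1).hom = _
  rw [complexBetti_map_comp_hom, ModuleCat.hom_comp]
  rfl

/-- `(f + g)^* = f^* + g^*` on `End A`. [cite: Milne1999LefschetzClasses, §1 p. 642] -/
private theorem pullbackOne_add' (f g : End A) : pullbackOne A (f + g) = pullbackOne A f + pullbackOne A g :=
  LinearMap.ext fun v => pullbackOne_add_apply (A := A) f g v

/-- `0^* = 0`. [cite: Milne1999LefschetzClasses, §1 p. 642] -/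
private theorem pullbackOne_zero : pullbackOne A (0 : End A) = 0 := by
  have h := pullbackOne_add' A 0 0
  rw [add_zero] at h
  exact add_right_cancel (h.symm.trans (zero_add _).symm)

/-- **The contravariant representation `φ ↦ φ^*` of `End(A)` on `H¹(A(ℂ); ℂ)`**, as a ring homomorphism
into the opposite algebra. [cite: Milne1999LefschetzClasses, §1 p. 642] -/
def pullbackRingHom : End A →+* EndHOneOp A where
  toFun φ := MulOpposite.op (pullbackOne A φ)
  map_one' := by rw [pullbackOne_one, MulOpposite.op_one]
  map_mul' f g := by rw [pullbackOne_mul, MulOpposite.op_mul]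
  map_zero' := by rw [pullbackOne_zero, MulOpposite.op_zero]
  map_add' f g := by rw [pullbackOne_add', MulOpposite.op_add]

/-- Unfolding lemma. [folklore] -/
@[simp] private theorem pullbackRingHom_apply (φ : End A) : pullbackRingHom A φ = MulOpposite.op (pullbackOne A φ) := rfl

/-- **The rational representation `End⁰(A) = ℚ ⊗ End(A) → (End_ℂ H¹)ᵒᵖ`**, `q ⊗ φ ↦ q φ^*`
(Mathlib `Algebra.TensorProduct.lift`). [cite: Milne1999LefschetzClasses, §1 p. 642] -/
def endAlgebraRepOp : A.endAlgebra →ₐ[ℚ] EndHOneOp A :=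
  Algebra.TensorProduct.lift (Algebra.ofId ℚ (EndHOneOp A))
    { pullbackRingHom A with
      commutes' := fun n ↦ RingHom.congr_fun (RingHom.ext_int
        ((pullbackRingHom A).comp (algebraMap ℤ (End A))) (algebraMap ℤ (EndHOneOp A))) n }
    fun q _ ↦ Algebra.commute_algebraMap_left q _

/-- `(q ⊗ φ) ↦ q · φ^*`. [cite: Milne1999LefschetzClasses, §1 p. 642] -/
theorem endAlgebraRepOp_tmul (q : ℚ) (φ : End A) :
    endAlgebraRepOp A (q ⊗ₜ[ℤ] φ) = algebraMap ℚ (EndHOneOp A) q * MulOpposite.op (pullbackOne A φ) := by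
  change Algebra.TensorProduct.lift _ _ _ (q ⊗ₜ[ℤ] φ) = _
  rw [Algebra.TensorProduct.lift_tmul]
  rfl

/-- **The complex representation `ℂ ⊗_ℚ End⁰(A) → (End_ℂ H¹)ᵒᵖ`**, `z ⊗ e ↦ z · e^*`.
[cite: Milne1999LefschetzClasses, §2 p. 645] -/
def complexEndAlgebraRepOp : ℂ ⊗[ℚ] A.endAlgebra →ₐ[ℂ] EndHOneOp A :=
  Algebra.TensorProduct.lift (Algebra.ofId ℂ (EndHOneOp A)) (endAlgebraRepOp A)
    fun z _ ↦ Algebra.commute_algebraMap_left z _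

/-- `(z ⊗ e) ↦ z · e^*`. [cite: Milne1999LefschetzClasses, §2 p. 645] -/
theorem complexEndAlgebraRepOp_tmul (z : ℂ) (e : A.endAlgebra) :
    complexEndAlgebraRepOp A (z ⊗ₜ[ℚ] e) = algebraMap ℂ (EndHOneOp A) z * endAlgebraRepOp A e := by
  change Algebra.TensorProduct.lift _ _ _ (z ⊗ₜ[ℚ] e) = _
  rw [Algebra.TensorProduct.lift_tmul]
  rfl

/-- **The representation `(ℂ ⊗_ℚ End⁰(A))ᵒᵖ → End_ℂ H¹(A(ℂ); ℂ)`** (un-opposited).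
[cite: Milne1999LefschetzClasses, §2 p. 645] -/
def complexEndAlgebraRep : (ℂ ⊗[ℚ] A.endAlgebra)ᵐᵒᵖ →+* Module.End ℂ (complexBetti A.X 1) :=
  (RingEquiv.opOp (Module.End ℂ (complexBetti A.X 1))).symm.toRingHom.comp
    (RingHom.op (complexEndAlgebraRepOp A).toRingHom)

/-- Unfolding lemma. [folklore] -/
private theorem complexEndAlgebraRep_op (r : ℂ ⊗[ℚ] A.endAlgebra) :
    complexEndAlgebraRep A (MulOpposite.op r) = MulOpposite.unop (complexEndAlgebraRepOp A r) := rfl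

/-- The bicommutant `E'' = (C(A) ⊗ ℂ)'`. [cite: Milne1999LefschetzClasses, §1 Remark 1.2 (p. 643)] -/
abbrev bicommutant : Subalgebra ℂ (Module.End ℂ (complexBetti A.X 1)) :=
  Subalgebra.centralizer ℂ (centralizerAlgebra A : Set (Module.End ℂ (complexBetti A.X 1)))

/-- Scalars lie in `E''`. [folklore] -/
private theorem algebraMap_mem_bicommutant (z : ℂ) :
    algebraMap ℂ (Module.End ℂ (complexBetti A.X 1)) z ∈ bicommutant A :=
  Subalgebra.algebraMap_mem _ z

/-- `(1 ⊗ φ) ↦ φ^*`. [cite: Milne1999LefschetzClasses, §1 p. 642] -/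
theorem endAlgebraRepOp_of (φ : End A) :
    endAlgebraRepOp A (AbelianVariety.endAlgebra.of A φ) = MulOpposite.op (pullbackOne A φ) := by
  change endAlgebraRepOp A ((1 : ℚ) ⊗ₜ[ℤ] φ) = _
  rw [endAlgebraRepOp_tmul, map_one, one_mul]

/-- The image of `End⁰(A)` lies in `E''` (every element of `End⁰(A)` is `M⁻¹ ⊗ F`).
[cite: Milne1999LefschetzClasses, §1 Remark 1.2 (p. 643)] -/
theorem unop_endAlgebraRepOp_mem (e : A.endAlgebra) :
    MulOpposite.unop (endAlgebraRepOp A e) ∈ bicommutant A := by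
  obtain ⟨M, F, -, rfl⟩ := AbelianVariety.endAlgebra.exists_eq_algebraMap_mul_of e
  rw [map_mul, AlgHom.commutes, endAlgebraRepOp_of, MulOpposite.unop_mul, MulOpposite.unop_op]
  refine Subalgebra.mul_mem _ (pullbackOne_mem_bicommutant F) ?_
  change MulOpposite.unop (algebraMap ℂ (EndHOneOp A) (((M : ℚ)⁻¹ : ℚ) : ℂ)) ∈ _
  rw [MulOpposite.algebraMap_apply, MulOpposite.unop_op]
  exact algebraMap_mem_bicommutant A _

/-- The image of `ℂ ⊗ End⁰(A)` lies in `E''`. [cite: Milne1999LefschetzClasses, §2 p. 645] -/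
theorem complexEndAlgebraRep_mem (r : (ℂ ⊗[ℚ] A.endAlgebra)ᵐᵒᵖ) :
    complexEndAlgebraRep A r ∈ bicommutant A := by
  induction r using MulOpposite.rec' with
  | h r =>
    rw [complexEndAlgebraRep_op]
    induction r using TensorProduct.induction_on with
    | zero => rw [map_zero, MulOpposite.unop_zero]; exact Subalgebra.zero_mem _
    | tmul z e =>
      rw [complexEndAlgebraRepOp_tmul, MulOpposite.unop_mul, MulOpposite.algebraMap_apply, MulOpposite.unop_op]
      exact Subalgebra.mul_mem _ (unop_endAlgebraRepOp_mem A e) (algebraMap_mem_bicommutant A z)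
    | add x y hx hy => rw [map_add, MulOpposite.unop_add]; exact Subalgebra.add_mem _ hx hy

/-- `φ^*` is in the image: `φ^* = ρ(op (1 ⊗ (1 ⊗ φ)))`. [cite: Milne1999LefschetzClasses, §1 p. 642] -/
theorem complexEndAlgebraRep_of (φ : End A) :
    complexEndAlgebraRep A (MulOpposite.op ((1 : ℂ) ⊗ₜ[ℚ] AbelianVariety.endAlgebra.of A φ)) = pullbackOne A φ := by
  rw [complexEndAlgebraRep_op, complexEndAlgebraRepOp_tmul, map_one, one_mul, endAlgebraRepOp_of,
    MulOpposite.unop_op]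

/-- Scalars are in the image: `z = ρ(op (z ⊗ 1))`. [folklore] -/
private theorem complexEndAlgebraRep_scalar (z : ℂ) :
    complexEndAlgebraRep A (MulOpposite.op (z ⊗ₜ[ℚ] (1 : A.endAlgebra))) =
      algebraMap ℂ (Module.End ℂ (complexBetti A.X 1)) z := by
  rw [complexEndAlgebraRep_op, complexEndAlgebraRepOp_tmul, map_one, mul_one, MulOpposite.algebraMap_apply,
    MulOpposite.unop_op]

/-- **`E''` is the image of `(ℂ ⊗_ℚ End⁰(A))ᵒᵖ`** (Riemann: `E''` is the `ℂ`-span of the `φ^*`,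
`mem_bicommutant_iff_mem_span`). [cite: Milne1999LefschetzClasses, §1 Remark 1.2 (p. 643)] -/
theorem exists_complexEndAlgebraRep_eq {X : Module.End ℂ (complexBetti A.X 1)} (hX : X ∈ bicommutant A) :
    ∃ r, complexEndAlgebraRep A r = X := by
  rw [mem_bicommutant_iff_mem_span] at hX
  induction hX using Submodule.span_induction with
  | mem _ h =>
    obtain ⟨φ, rfl⟩ := h
    exact ⟨_, complexEndAlgebraRep_of A φ⟩
  | zero => exact ⟨0, map_zero _⟩
  | add _ _ _ _ hx hy =>
    obtain ⟨r, rfl⟩ := hx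
    obtain ⟨s, rfl⟩ := hy
    exact ⟨r + s, map_add _ _ _⟩
  | smul z _ _ hx =>
    obtain ⟨r, rfl⟩ := hx
    refine ⟨MulOpposite.op (z ⊗ₜ[ℚ] (1 : A.endAlgebra)) * r, ?_⟩
    rw [map_mul, complexEndAlgebraRep_scalar, Algebra.smul_def]

/-- The representation, co-restricted to `E''`. [cite: Milne1999LefschetzClasses, §2 p. 645] -/
def complexEndAlgebraRepBicommutant : (ℂ ⊗[ℚ] A.endAlgebra)ᵐᵒᵖ →+* bicommutant A :=
  (complexEndAlgebraRep A).codRestrict (bicommutant A) (complexEndAlgebraRep_mem A)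

/-- It is surjective. [cite: Milne1999LefschetzClasses, §1 Remark 1.2 (p. 643)] -/
theorem complexEndAlgebraRepBicommutant_surjective : Function.Surjective (complexEndAlgebraRepBicommutant A) := by
  rintro ⟨X, hX⟩
  obtain ⟨r, hr⟩ := exists_complexEndAlgebraRep_eq A hX
  exact ⟨r, Subtype.ext hr⟩

/-- **`ℂ ⊗_ℚ End⁰(A)` is semisimple** (Poincaré + base change in characteristic `0`).
[cite: Milne1999LefschetzClasses, §2 p. 645] [cite: MumfordAV1970, §19 Cor. 2 of Thm. 1] -/
instance isSemisimpleRing_complex_tensor_endAlgebra : IsSemisimpleRing (ℂ ⊗[ℚ] A.endAlgebra) := by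
  haveI : IsSemisimpleRing A.endAlgebra := AbelianVariety.isSemisimpleRing_endAlgebra_of_perfectField A
  exact Literature.RingTheory.SimpleModule.isSemisimpleRing_baseChange ℚ A.endAlgebra ℂ

/-- **The bicommutant `E'' = End⁰(A) ⊗ ℂ ⊆ End_ℂ H¹(A(ℂ); ℂ)` is a semisimple ring.**
[cite: Milne1999LefschetzClasses, §1 p. 642 and §2 p. 645] [cite: MumfordAV1970, §19 Cor. 2 of Thm. 1] -/
theorem isSemisimpleRing_bicommutant : IsSemisimpleRing (bicommutant A) :=
  RingHom.isSemisimpleRing_of_surjective (complexEndAlgebraRepBicommutant A)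
    (complexEndAlgebraRepBicommutant_surjective A)

end Literature.AlgebraicGeometry.Milne1999

end
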